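import Summits.CriticalPhenomena.PercolationContinuityZ3.Theorems.PercNearOneGluingNoHeavyLowerTailApexTwoSumPointwise
import Summits.CriticalPhenomena.PercolationContinuityZ3.Theorems.PercNearOneGluingNoHeavyLowerTailGZHub
import Literature.Probability.Percolation.TwoClusterGibbsCovariance
import HarnessLib

/-!
# `NoHeavyLowerTail` (stmt-CriticalPhenomena-4575) — 2-sums through the apex, part 4:
# the cell masses of the glued random-cluster measure as bilinear forms in the arms' wired cell masses

Support file (prover prim-gen-kcluster gen 72; `--supports stmt-CriticalPhenomena-4575`).  No definitions, no
named facts, no sorries.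

SETTING as in parts 1–3: apex `a`, hub `h`, arms `DX ∋ b`, `DY ∋ c` meeting only in `{a, h}`; parameters `w`
vanishing off `DX ∪ DY`, arm parameters `wX` (`= w` on `DX`, `0` off `DX`) and `wY` (`= w` off `DX`, `0` on `DX`);
`T = {a, h}`.  The `T`-WIRED unnormalised cell masses of the arm `X` are `R_X(σ) = Σ_η rcWeightW wX q T η · 1_σ(η)`
for the arm cells `σ ∈ {A, B, C, D, E, N}` of part 2 (terminal `b`); likewise `R_Y(σ)` (terminal `c`).
* `ApexTwoSum.sum_weight_blocks_rc` — independence of the blocks: `Σ_ω weight_w(ω) (f(ω ∩ DX) q^{k^T(ω ∩ DX)})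
  (g(ω ∖ DX) q^{k^T(ω ∖ DX)}) = (Σ_η rcWeightW_{wX} f)(Σ_η rcWeightW_{wY} g)` (`BHK2006.blockFubini`,
  `BHK2006.integral_comp_sdiff_prodBernoulli'`).
* THE DICTIONARY (`K = q^{k^T(∅)}`, `Zφ(·)` = unnormalised mass under `φ = rcMeasureW w q ∅`):
  `ApexTwoSum.glued_T_sum`:  `K·Zφ(T)   = R_X(A)R_Y(A) + R_X(A)R_Y(C) + R_X(A)R_Y(D) + R_X(C)R_Y(A) + q R_X(C)R_Y(C) + R_X(D)R_Y(A)`,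
  `ApexTwoSum.glued_Ub_sum`: `K·Zφ(U_b) = R_X(A)R_Y(B) + R_X(A)R_Y(E) + R_X(C)R_Y(B) + q R_X(C)R_Y(D) + q R_X(C)R_Y(E) + R_X(D)R_Y(B)`,
  `ApexTwoSum.glued_Uc_sum`: the mirror image,
  `ApexTwoSum.glued_S_sum`:  `K·Zφ(S)   = R_X(B)R_Y(B) + R_X(B)R_Y(E) + R_X(E)R_Y(B) + q R_X(N)R_Y(D) + q R_X(N)R_Y(E) + q R_X(D)R_Y(N)
                                            + q R_X(E)R_Y(N) − q R_X(N)R_Y(N)`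
  (validated numerically beforehand: HOME/code/gen72/twosum_wired_check.py, exact arithmetic).
Part 5 feeds these into the kernel certificate `ThetaBlocks.R10_cert` (p367913).
-/

noncomputable section

namespace Summit.CriticalPhenomena.PercolationContinuityZ3.Theorems

namespace ApexTwoSum

open Finset SimpleGraph Literature.Probability.Percolation Literature.Probability.Percolation.Gladkov
open Literature.Probability.Percolation.BHK2006 (weight blockFubini integral_prodBernoulli_eq_sum)
open Literature.Probability.Percolation.DecisionTree (ind ind_of_mem ind_of_not_mem)
open Literature.Probability.LatticeModels RefinedRowR3 ThreePointLB MeasureTheory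
open scoped Classical

variable {V : Type*} [Fintype V]

/-! ### Independence of the two blocks -/

/-- **Independence of the blocks, random-cluster form.**  If `wX` is `w` on `A` and `0` off `A`, and `wY` is `w` off `A`
and `0` on `A`, then for all `f, g` and every wired set `B`:
`Σ_ω weight_w(ω) (f(ω ∩ A) q^{k^B(ω ∩ A)}) (g(ω ∖ A) q^{k^B(ω ∖ A)}) = (Σ_η rcWeightW_{wX}(η) f(η)) (Σ_η rcWeightW_{wY}(η) g(η))`.
[folklore] -/
theorem sum_weight_blocks_rc (w wX wY : Sym2 V → unitInterval) (A : Set (Sym2 V))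
    (hX : ∀ e ∈ A, wX e = w e) (hX' : ∀ e ∉ A, wX e = 0)
    (hY : ∀ e ∈ A, wY e = 0) (hY' : ∀ e ∉ A, wY e = w e) (q : ℝ) (B : Set V) (f g : Set (Sym2 V) → ℝ) :
    ∑ ω : Set (Sym2 V), weight (fun e => (w e : ℝ)) ω *
        ((f (ω ∩ A) * q ^ clusterCount (ω ∩ A) B) * (g (ω \ A) * q ^ clusterCount (ω \ A) B)) =
      (∑ η : Set (Sym2 V), rcWeightW wX q B η * f η) * ∑ η : Set (Sym2 V), rcWeightW wY q B η * g η := by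
  set F : Set (Sym2 V) → ℝ := fun x => f x * q ^ clusterCount x B with hF
  set G : Set (Sym2 V) → ℝ := fun y => g y * q ^ clusterCount y B with hG
  have hfub := blockFubini (fun e => (w e : ℝ)) A (fun x y => F x * G y)
  rw [GZHub.sum_weight, one_mul] at hfub
  have eF : ∀ η : Set (Sym2 V), rcWeightW wX q B η * f η = weight (fun e => (wX e : ℝ)) η * F η := fun η => by
    simp only [hF]; unfold rcWeightW; ring
  have eG : ∀ η : Set (Sym2 V), rcWeightW wY q B η * g η = weight (fun e => (wY e : ℝ)) η * G η := fun η => by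
    simp only [hG]; unfold rcWeightW; ring
  rw [Finset.sum_congr rfl fun η _ => eF η, Finset.sum_congr rfl fun η _ => eG η]
  change ∑ ω : Set (Sym2 V), weight (fun e => (w e : ℝ)) ω * (F (ω ∩ A) * G (ω \ A)) = _
  rw [hfub]
  -- inner sums: the `Aᶜ`-block is a fresh configuration with parameters `wY`
  have hin : ∀ ω : Set (Sym2 V), ∑ ω', weight (fun e => (w e : ℝ)) ω' * (F (ω ∩ A) * G (ω' \ A)) =
      F (ω ∩ A) * ∑ η : Set (Sym2 V), weight (fun e => (wY e : ℝ)) η * G η := by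
    intro ω
    have h2 : ∑ ω', weight (fun e => (w e : ℝ)) ω' * G (ω' \ A) =
        ∑ η : Set (Sym2 V), weight (fun e => (wY e : ℝ)) η * G η := by
      rw [← integral_prodBernoulli_eq_sum, ← integral_prodBernoulli_eq_sum]
      exact BHK2006.integral_comp_sdiff_prodBernoulli' w wY A hY hY' G
    rw [← h2, Finset.mul_sum]
    exact Finset.sum_congr rfl fun ω' _ => by ring
  simp_rw [hin]
  rw [show (∑ x : Set (Sym2 V), weight (fun e => (w e : ℝ)) x *
      (F (x ∩ A) * ∑ η : Set (Sym2 V), weight (fun e => (wY e : ℝ)) η * G η)) =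
      (∑ x : Set (Sym2 V), weight (fun e => (w e : ℝ)) x * F (x ∩ A)) *
        ∑ η : Set (Sym2 V), weight (fun e => (wY e : ℝ)) η * G η by
    rw [Finset.sum_mul]; exact Finset.sum_congr rfl fun x _ => by ring]
  congr 1
  -- outer sum: the `A`-block is a fresh configuration with parameters `wX`
  have h3 : ∑ ω : Set (Sym2 V), weight (fun e => (w e : ℝ)) ω * F (ω \ Aᶜ) =
      ∑ η : Set (Sym2 V), weight (fun e => (wX e : ℝ)) η * F η := by
    rw [← integral_prodBernoulli_eq_sum, ← integral_prodBernoulli_eq_sum]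
    exact BHK2006.integral_comp_sdiff_prodBernoulli' w wX Aᶜ (fun e he => hX' e he)
      (fun e he => hX e (not_not.1 he)) F
  rw [← h3]
  exact Finset.sum_congr rfl fun ω _ => by rw [Set.sdiff_compl]

/-! ### The dictionary -/

section Sums

variable {DX DY : Finset (Sym2 V)} {a h b c : V} (hah : a ≠ h) (hab : a ≠ b) (hac : a ≠ c) (hbc : b ≠ c)
  (hhb : h ≠ b) (hhc : h ≠ c)
  (hsepD : ∀ v : V, (∃ e ∈ DX, v ∈ e) → (∃ e ∈ DY, v ∈ e) → (v = a ∨ v = h))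
  (hbY : ∀ e ∈ DY, b ∉ e) (hcX : ∀ e ∈ DX, c ∉ e)
  (w wX wY : Sym2 V → unitInterval) (q : ℝ) (hw : ∀ e, e ∉ (↑DX ∪ ↑DY : Set (Sym2 V)) → (w e : ℝ) = 0)
  (hX : ∀ e ∈ (↑DX : Set (Sym2 V)), wX e = w e) (hX' : ∀ e ∉ (↑DX : Set (Sym2 V)), wX e = 0)
  (hY : ∀ e ∈ (↑DX : Set (Sym2 V)), wY e = 0) (hY' : ∀ e ∉ (↑DX : Set (Sym2 V)), wY e = w e)
include hah hab hac hsepD hbY hcX hw hX hX' hY hY'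

/-- **Dictionary, cell `T = {b, c ∈ C(a)}`** (see the module docstring). [this work] -/
theorem glued_T_sum :
    (∑ ω : BondConfig V, rcWeightW w q ∅ ω * ind {η : BondConfig V | b ∈ cl η.toFinset a ∧ c ∈ cl η.toFinset a} ω) * q ^ clusterCount (∅ : BondConfig V) ({a, h} : Set V) =
      (∑ η : BondConfig V, rcWeightW wX q ({a, h} : Set V) η * ind {η : BondConfig V | b ∈ cl η.toFinset a ∧ h ∈ cl η.toFinset a} η) * (∑ η : BondConfig V, rcWeightW wY q ({a, h} : Set V) η * ind {η : BondConfig V | c ∈ cl η.toFinset a ∧ h ∈ cl η.toFinset a} η) + (∑ η : BondConfig V, rcWeightW wX q ({a, h} : Set V) η * ind {η : BondConfig V | b ∈ cl η.toFinset a ∧ h ∈ cl η.toFinset a} η) * (∑ η : BondConfig V, rcWeightW wY q ({a, h} : Set V) η * ind {η : BondConfig V | c ∈ cl η.toFinset a ∧ h ∉ cl η.toFinset a} η) + (∑ η : BondConfig V, rcWeightW wX q ({a, h} : Set V) η * ind {η : BondConfig V | b ∈ cl η.toFinset a ∧ h ∈ cl η.toFinset a} η) * (∑ η : BondConfig V,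 rcWeightW wY q ({a, h} : Set V) η * ind {η : BondConfig V | c ∉ cl η.toFinset a ∧ h ∉ cl η.toFinset a ∧ h ∈ cl η.toFinset c} η) + (∑ η : BondConfig V, rcWeightW wX q ({a, h} : Set V) η * ind {η : BondConfig V | b ∈ cl η.toFinset a ∧ h ∉ cl η.toFinset a} η) * (∑ η : BondConfig V, rcWeightW wY q ({a, h} : Set V) η * ind {η : BondConfig V | c ∈ cl η.toFinset a ∧ h ∈ cl η.toFinset a} η) + q * ((∑ η : BondConfig V, rcWeightW wX q ({a, h} : Set V) η * ind {η : BondConfig V | b ∈ cl η.toFinset a ∧ h ∉ cl η.toFinset a} η) * (∑ η : BondConfig V, rcWeightW wY q ({a, h} : Set V) η * ind {η : BondConfig V | c ∈ cl η.toFinset a ∧ h ∉ cl η.toFinset a} η)) + (∑ η : BondConfig V, rcWeightW wX q ({a, h} : Set V) η * ind {η : BondConfig V | b ∉ cl η.toFinset a ∧ h ∉ cl η.toFinset a ∧ h ∈ cl η.toFinset b} η) * (∑ η : BondConfig V, rcWeightW wY q ({a, h} : Set V) η * ind {η : BondConfig V | c ∈ cl η.toFinset a ∧ h ∈ cl η.toFinset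 a} η) := by
  rw [Finset.sum_mul, Finset.sum_congr rfl fun ω _ => pt_T hah hab hac hsepD hbY hcX w q hw ω]
  have e1 := sum_weight_blocks_rc w wX wY (↑DX) hX hX' hY hY' q ({a, h} : Set V) (fun x => ind {η : BondConfig V | b ∈ cl η.toFinset a ∧ h ∈ cl η.toFinset a} x) (fun y => ind {η : BondConfig V | c ∈ cl η.toFinset a ∧ h ∈ cl η.toFinset a} y)
  have e2 := sum_weight_blocks_rc w wX wY (↑DX) hX hX' hY hY' q ({a, h} : Set V) (fun x => ind {η : BondConfig V | b ∈ cl η.toFinset a ∧ h ∈ cl η.toFinset a} x) (fun y => ind {η : BondConfig V | c ∈ cl η.toFinset a ∧ h ∉ cl η.toFinset a} y)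
  have e3 := sum_weight_blocks_rc w wX wY (↑DX) hX hX' hY hY' q ({a, h} : Set V) (fun x => ind {η : BondConfig V | b ∈ cl η.toFinset a ∧ h ∈ cl η.toFinset a} x) (fun y => ind {η : BondConfig V | c ∉ cl η.toFinset a ∧ h ∉ cl η.toFinset a ∧ h ∈ cl η.toFinset c} y)
  have e4 := sum_weight_blocks_rc w wX wY (↑DX) hX hX' hY hY' q ({a, h} : Set V) (fun x => ind {η : BondConfig V | b ∈ cl η.toFinset a ∧ h ∉ cl η.toFinset a} x) (fun y => ind {η : BondConfig V | c ∈ cl η.toFinset a ∧ h ∈ cl η.toFinset a} y)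
  have e5 := sum_weight_blocks_rc w wX wY (↑DX) hX hX' hY hY' q ({a, h} : Set V) (fun x => ind {η : BondConfig V | b ∈ cl η.toFinset a ∧ h ∉ cl η.toFinset a} x) (fun y => ind {η : BondConfig V | c ∈ cl η.toFinset a ∧ h ∉ cl η.toFinset a} y)
  have e6 := sum_weight_blocks_rc w wX wY (↑DX) hX hX' hY hY' q ({a, h} : Set V) (fun x => ind {η : BondConfig V | b ∉ cl η.toFinset a ∧ h ∉ cl η.toFinset a ∧ h ∈ cl η.toFinset b} x) (fun y => ind {η : BondConfig V | c ∈ cl η.toFinset a ∧ h ∈ cl η.toFinset a} y)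
  beta_reduce at e1 e2 e3 e4 e5 e6
  rw [← e1, ← e2, ← e3, ← e4, ← e5, ← e6]
  simp only [Finset.mul_sum]
  rw [← Finset.sum_add_distrib, ← Finset.sum_add_distrib, ← Finset.sum_add_distrib, ← Finset.sum_add_distrib, ← Finset.sum_add_distrib]
  refine Finset.sum_congr rfl fun ω _ => by ring

/-- **Dictionary, cell `U_b = {b ∈ C(a), c ∉ C(a)}`**. [this work] -/
theorem glued_Ub_sum :
    (∑ ω : BondConfig V, rcWeightW w q ∅ ω * ind {η : BondConfig V | b ∈ cl η.toFinset a ∧ c ∉ cl η.toFinset a} ω) * q ^ clusterCount (∅ : BondConfig V) ({a, h} : Set V) =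
      (∑ η : BondConfig V, rcWeightW wX q ({a, h} : Set V) η * ind {η : BondConfig V | b ∈ cl η.toFinset a ∧ h ∈ cl η.toFinset a} η) * (∑ η : BondConfig V, rcWeightW wY q ({a, h} : Set V) η * ind {η : BondConfig V | c ∉ cl η.toFinset a ∧ h ∈ cl η.toFinset a} η) + (∑ η : BondConfig V, rcWeightW wX q ({a, h} : Set V) η * ind {η : BondConfig V | b ∈ cl η.toFinset a ∧ h ∈ cl η.toFinset a} η) * (∑ η : BondConfig V, rcWeightW wY q ({a, h} : Set V) η * ind {η : BondConfig V | c ∉ cl η.toFinset a ∧ h ∉ cl η.toFinset a ∧ h ∉ cl η.toFinset c} η) + (∑ η : BondConfig V, rcWeightW wX q ({a, h} : Set V) η * ind {η : BondConfig V | b ∈ cl η.toFinset a ∧ h ∉ cl η.toFinset a} η) * (∑ η : BondConfig V, rcWeightW wY q ({a, h} : Set V) η * ind {η : BondConfig V | c ∉ cl η.toFinset a ∧ h ∈ cl η.toFinset a} η) + q * ((∑ η : BondConfig V, rcWeightW wX q ({a, h} : Set V) η * ind {η : BondConfig V | b ∈ cl η.toFinset a ∧ h ∉ cl η.toFinset a}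 η) * (∑ η : BondConfig V, rcWeightW wY q ({a, h} : Set V) η * ind {η : BondConfig V | c ∉ cl η.toFinset a ∧ h ∉ cl η.toFinset a ∧ h ∈ cl η.toFinset c} η)) + q * ((∑ η : BondConfig V, rcWeightW wX q ({a, h} : Set V) η * ind {η : BondConfig V | b ∈ cl η.toFinset a ∧ h ∉ cl η.toFinset a} η) * (∑ η : BondConfig V, rcWeightW wY q ({a, h} : Set V) η * ind {η : BondConfig V | c ∉ cl η.toFinset a ∧ h ∉ cl η.toFinset a ∧ h ∉ cl η.toFinset c} η)) + (∑ η : BondConfig V, rcWeightW wX q ({a, h} : Set V) η * ind {η : BondConfig V | b ∉ cl η.toFinset a ∧ h ∉ cl η.toFinset a ∧ h ∈ cl η.toFinset b} η) * (∑ η : BondConfig V, rcWeightW wY q ({a, h} : Set V) η * ind {η : BondConfig V | c ∉ cl η.toFinset a ∧ h ∈ cl η.toFinset a} η) := by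
  rw [Finset.sum_mul, Finset.sum_congr rfl fun ω _ => pt_Ub hah hab hac hsepD hbY hcX w q hw ω]
  have e1 := sum_weight_blocks_rc w wX wY (↑DX) hX hX' hY hY' q ({a, h} : Set V) (fun x => ind {η : BondConfig V | b ∈ cl η.toFinset a ∧ h ∈ cl η.toFinset a} x) (fun y => ind {η : BondConfig V | c ∉ cl η.toFinset a ∧ h ∈ cl η.toFinset a} y)
  have e2 := sum_weight_blocks_rc w wX wY (↑DX) hX hX' hY hY' q ({a, h} : Set V) (fun x => ind {η : BondConfig V | b ∈ cl η.toFinset a ∧ h ∈ cl η.toFinset a} x) (fun y => ind {η : BondConfig V | c ∉ cl η.toFinset a ∧ h ∉ cl η.toFinset a ∧ h ∉ cl η.toFinset c} y)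
  have e3 := sum_weight_blocks_rc w wX wY (↑DX) hX hX' hY hY' q ({a, h} : Set V) (fun x => ind {η : BondConfig V | b ∈ cl η.toFinset a ∧ h ∉ cl η.toFinset a} x) (fun y => ind {η : BondConfig V | c ∉ cl η.toFinset a ∧ h ∈ cl η.toFinset a} y)
  have e4 := sum_weight_blocks_rc w wX wY (↑DX) hX hX' hY hY' q ({a, h} : Set V) (fun x => ind {η : BondConfig V | b ∈ cl η.toFinset a ∧ h ∉ cl η.toFinset a} x) (fun y => ind {η : BondConfig V | c ∉ cl η.toFinset a ∧ h ∉ cl η.toFinset a ∧ h ∈ cl η.toFinset c} y)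
  have e5 := sum_weight_blocks_rc w wX wY (↑DX) hX hX' hY hY' q ({a, h} : Set V) (fun x => ind {η : BondConfig V | b ∈ cl η.toFinset a ∧ h ∉ cl η.toFinset a} x) (fun y => ind {η : BondConfig V | c ∉ cl η.toFinset a ∧ h ∉ cl η.toFinset a ∧ h ∉ cl η.toFinset c} y)
  have e6 := sum_weight_blocks_rc w wX wY (↑DX) hX hX' hY hY' q ({a, h} : Set V) (fun x => ind {η : BondConfig V | b ∉ cl η.toFinset a ∧ h ∉ cl η.toFinset a ∧ h ∈ cl η.toFinset b} x) (fun y => ind {η : BondConfig V | c ∉ cl η.toFinset a ∧ h ∈ cl η.toFinset a} y)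
  beta_reduce at e1 e2 e3 e4 e5 e6
  rw [← e1, ← e2, ← e3, ← e4, ← e5, ← e6]
  simp only [Finset.mul_sum]
  rw [← Finset.sum_add_distrib, ← Finset.sum_add_distrib, ← Finset.sum_add_distrib, ← Finset.sum_add_distrib, ← Finset.sum_add_distrib]
  refine Finset.sum_congr rfl fun ω _ => by ring

/-- **Dictionary, cell `U_c = {b ∉ C(a), c ∈ C(a)}`**. [this work] -/
theorem glued_Uc_sum :
    (∑ ω : BondConfig V, rcWeightW w q ∅ ω * ind {η : BondConfig V | b ∉ cl η.toFinset a ∧ c ∈ cl η.toFinset a} ω) * q ^ clusterCount (∅ : BondConfig V) ({a, h} : Set V) =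
      (∑ η : BondConfig V, rcWeightW wX q ({a, h} : Set V) η * ind {η : BondConfig V | b ∉ cl η.toFinset a ∧ h ∈ cl η.toFinset a} η) * (∑ η : BondConfig V, rcWeightW wY q ({a, h} : Set V) η * ind {η : BondConfig V | c ∈ cl η.toFinset a ∧ h ∈ cl η.toFinset a} η) + (∑ η : BondConfig V, rcWeightW wX q ({a, h} : Set V) η * ind {η : BondConfig V | b ∉ cl η.toFinset a ∧ h ∉ cl η.toFinset a ∧ h ∉ cl η.toFinset b} η) * (∑ η : BondConfig V, rcWeightW wY q ({a, h} : Set V) η * ind {η : BondConfig V | c ∈ cl η.toFinset a ∧ h ∈ cl η.toFinset a} η) + (∑ η : BondConfig V, rcWeightW wX q ({a, h} : Set V) η * ind {η : BondConfig V | b ∉ cl η.toFinset a ∧ h ∈ cl η.toFinset a} η) * (∑ η : BondConfig V, rcWeightW wY q ({a, h} : Set V) η * ind {η : BondConfig V | c ∈ cl η.toFinset a ∧ h ∉ cl η.toFinset a} η) + q * ((∑ η : BondConfig V, rcWeightW wX q ({a, h} : Set V) η * ind {η : BondConfig V | b ∉ cl η.toFinset a ∧ h ∉ cl η.toFinset a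 ∧ h ∈ cl η.toFinset b} η) * (∑ η : BondConfig V, rcWeightW wY q ({a, h} : Set V) η * ind {η : BondConfig V | c ∈ cl η.toFinset a ∧ h ∉ cl η.toFinset a} η)) + q * ((∑ η : BondConfig V, rcWeightW wX q ({a, h} : Set V) η * ind {η : BondConfig V | b ∉ cl η.toFinset a ∧ h ∉ cl η.toFinset a ∧ h ∉ cl η.toFinset b} η) * (∑ η : BondConfig V, rcWeightW wY q ({a, h} : Set V) η * ind {η : BondConfig V | c ∈ cl η.toFinset a ∧ h ∉ cl η.toFinset a} η)) + (∑ η : BondConfig V, rcWeightW wX q ({a, h} : Set V) η * ind {η : BondConfig V | b ∉ cl η.toFinset a ∧ h ∈ cl η.toFinset a} η) * (∑ η : BondConfig V, rcWeightW wY q ({a, h} : Set V) η * ind {η : BondConfig V | c ∉ cl η.toFinset a ∧ h ∉ cl η.toFinset a ∧ h ∈ cl η.toFinset c} η) := by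
  rw [Finset.sum_mul, Finset.sum_congr rfl fun ω _ => pt_Uc hah hab hac hsepD hbY hcX w q hw ω]
  have e1 := sum_weight_blocks_rc w wX wY (↑DX) hX hX' hY hY' q ({a, h} : Set V) (fun x => ind {η : BondConfig V | b ∉ cl η.toFinset a ∧ h ∈ cl η.toFinset a} x) (fun y => ind {η : BondConfig V | c ∈ cl η.toFinset a ∧ h ∈ cl η.toFinset a} y)
  have e2 := sum_weight_blocks_rc w wX wY (↑DX) hX hX' hY hY' q ({a, h} : Set V) (fun x => ind {η : BondConfig V | b ∉ cl η.toFinset a ∧ h ∉ cl η.toFinset a ∧ h ∉ cl η.toFinset b} x) (fun y => ind {η : BondConfig V | c ∈ cl η.toFinset a ∧ h ∈ cl η.toFinset a} y)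
  have e3 := sum_weight_blocks_rc w wX wY (↑DX) hX hX' hY hY' q ({a, h} : Set V) (fun x => ind {η : BondConfig V | b ∉ cl η.toFinset a ∧ h ∈ cl η.toFinset a} x) (fun y => ind {η : BondConfig V | c ∈ cl η.toFinset a ∧ h ∉ cl η.toFinset a} y)
  have e4 := sum_weight_blocks_rc w wX wY (↑DX) hX hX' hY hY' q ({a, h} : Set V) (fun x => ind {η : BondConfig V | b ∉ cl η.toFinset a ∧ h ∉ cl η.toFinset a ∧ h ∈ cl η.toFinset b} x) (fun y => ind {η : BondConfig V | c ∈ cl η.toFinset a ∧ h ∉ cl η.toFinset a} y)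
  have e5 := sum_weight_blocks_rc w wX wY (↑DX) hX hX' hY hY' q ({a, h} : Set V) (fun x => ind {η : BondConfig V | b ∉ cl η.toFinset a ∧ h ∉ cl η.toFinset a ∧ h ∉ cl η.toFinset b} x) (fun y => ind {η : BondConfig V | c ∈ cl η.toFinset a ∧ h ∉ cl η.toFinset a} y)
  have e6 := sum_weight_blocks_rc w wX wY (↑DX) hX hX' hY hY' q ({a, h} : Set V) (fun x => ind {η : BondConfig V | b ∉ cl η.toFinset a ∧ h ∈ cl η.toFinset a} x) (fun y => ind {η : BondConfig V | c ∉ cl η.toFinset a ∧ h ∉ cl η.toFinset a ∧ h ∈ cl η.toFinset c} y)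
  beta_reduce at e1 e2 e3 e4 e5 e6
  rw [← e1, ← e2, ← e3, ← e4, ← e5, ← e6]
  simp only [Finset.mul_sum]
  rw [← Finset.sum_add_distrib, ← Finset.sum_add_distrib, ← Finset.sum_add_distrib, ← Finset.sum_add_distrib, ← Finset.sum_add_distrib]
  refine Finset.sum_congr rfl fun ω _ => by ring

include hbc hhb hhc in
/-- **Dictionary, separating cell `S`**. [this work] -/
theorem glued_S_sum :
    (∑ ω : BondConfig V, rcWeightW w q ∅ ω * ind {η : BondConfig V | b ∉ cl η.toFinset a ∧ c ∉ cl η.toFinset a ∧ Sep (DX ∪ DY) (cl η.toFinset a) b c} ω) * q ^ clusterCount (∅ : BondConfig V) ({a, h} : Set V) =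
      (∑ η : BondConfig V, rcWeightW wX q ({a, h} : Set V) η * ind {η : BondConfig V | b ∉ cl η.toFinset a ∧ h ∈ cl η.toFinset a} η) * (∑ η : BondConfig V, rcWeightW wY q ({a, h} : Set V) η * ind {η : BondConfig V | c ∉ cl η.toFinset a ∧ h ∈ cl η.toFinset a} η) + (∑ η : BondConfig V, rcWeightW wX q ({a, h} : Set V) η * ind {η : BondConfig V | b ∉ cl η.toFinset a ∧ h ∈ cl η.toFinset a} η) * (∑ η : BondConfig V, rcWeightW wY q ({a, h} : Set V) η * ind {η : BondConfig V | c ∉ cl η.toFinset a ∧ h ∉ cl η.toFinset a ∧ h ∉ cl η.toFinset c} η) + (∑ η : BondConfig V, rcWeightW wX q ({a, h} : Set V) η * ind {η : BondConfig V | b ∉ cl η.toFinset a ∧ h ∉ cl η.toFinset a ∧ h ∉ cl η.toFinset b} η) * (∑ η : BondConfig V, rcWeightW wY q ({a, h} : Set V) η * ind {η : BondConfig V | c ∉ cl η.toFinset a ∧ h ∈ cl η.toFinset a} η) + q * ((∑ η : BondConfig V, rcWeightW wX q ({a, h} : Set V) η * ind {η : BondConfig V | b ∉ cl η.toFinset a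 ∧ h ∉ cl η.toFinset a ∧ Sep DX (cl η.toFinset a) b h} η) * (∑ η : BondConfig V, rcWeightW wY q ({a, h} : Set V) η * ind {η : BondConfig V | c ∉ cl η.toFinset a ∧ h ∉ cl η.toFinset a ∧ h ∈ cl η.toFinset c} η)) + q * ((∑ η : BondConfig V, rcWeightW wX q ({a, h} : Set V) η * ind {η : BondConfig V | b ∉ cl η.toFinset a ∧ h ∉ cl η.toFinset a ∧ Sep DX (cl η.toFinset a) b h} η) * (∑ η : BondConfig V, rcWeightW wY q ({a, h} : Set V) η * ind {η : BondConfig V | c ∉ cl η.toFinset a ∧ h ∉ cl η.toFinset a ∧ h ∉ cl η.toFinset c} η)) + q * ((∑ η : BondConfig V, rcWeightW wX q ({a, h} : Set V) η * ind {η : BondConfig V | b ∉ cl η.toFinset a ∧ h ∉ cl η.toFinset a ∧ h ∈ cl η.toFinset b} η) * (∑ η : BondConfig V, rcWeightW wY q ({a, h} : Set V) η * ind {η : BondConfig V | c ∉ cl η.toFinset a ∧ h ∉ cl η.toFinset a ∧ Sep DY (cl η.toFinset a) c h} η)) + q * ((∑ η : BondConfig V, rcWeightW wX q ({a, h} : Set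 V) η * ind {η : BondConfig V | b ∉ cl η.toFinset a ∧ h ∉ cl η.toFinset a ∧ h ∉ cl η.toFinset b} η) * (∑ η : BondConfig V, rcWeightW wY q ({a, h} : Set V) η * ind {η : BondConfig V | c ∉ cl η.toFinset a ∧ h ∉ cl η.toFinset a ∧ Sep DY (cl η.toFinset a) c h} η)) - q * ((∑ η : BondConfig V, rcWeightW wX q ({a, h} : Set V) η * ind {η : BondConfig V | b ∉ cl η.toFinset a ∧ h ∉ cl η.toFinset a ∧ Sep DX (cl η.toFinset a) b h} η) * (∑ η : BondConfig V, rcWeightW wY q ({a, h} : Set V) η * ind {η : BondConfig V | c ∉ cl η.toFinset a ∧ h ∉ cl η.toFinset a ∧ Sep DY (cl η.toFinset a) c h} η)) := by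
  rw [Finset.sum_mul, Finset.sum_congr rfl fun ω _ => pt_S hah hab hac hbc hhb hhc hsepD hbY hcX w q hw ω]
  have e1 := sum_weight_blocks_rc w wX wY (↑DX) hX hX' hY hY' q ({a, h} : Set V) (fun x => ind {η : BondConfig V | b ∉ cl η.toFinset a ∧ h ∈ cl η.toFinset a} x) (fun y => ind {η : BondConfig V | c ∉ cl η.toFinset a ∧ h ∈ cl η.toFinset a} y)
  have e2 := sum_weight_blocks_rc w wX wY (↑DX) hX hX' hY hY' q ({a, h} : Set V) (fun x => ind {η : BondConfig V | b ∉ cl η.toFinset a ∧ h ∈ cl η.toFinset a} x) (fun y => ind {η : BondConfig V | c ∉ cl η.toFinset a ∧ h ∉ cl η.toFinset a ∧ h ∉ cl η.toFinset c} y)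
  have e3 := sum_weight_blocks_rc w wX wY (↑DX) hX hX' hY hY' q ({a, h} : Set V) (fun x => ind {η : BondConfig V | b ∉ cl η.toFinset a ∧ h ∉ cl η.toFinset a ∧ h ∉ cl η.toFinset b} x) (fun y => ind {η : BondConfig V | c ∉ cl η.toFinset a ∧ h ∈ cl η.toFinset a} y)
  have e4 := sum_weight_blocks_rc w wX wY (↑DX) hX hX' hY hY' q ({a, h} : Set V) (fun x => ind {η : BondConfig V | b ∉ cl η.toFinset a ∧ h ∉ cl η.toFinset a ∧ Sep DX (cl η.toFinset a) b h} x) (fun y => ind {η : BondConfig V | c ∉ cl η.toFinset a ∧ h ∉ cl η.toFinset a ∧ h ∈ cl η.toFinset c} y)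
  have e5 := sum_weight_blocks_rc w wX wY (↑DX) hX hX' hY hY' q ({a, h} : Set V) (fun x => ind {η : BondConfig V | b ∉ cl η.toFinset a ∧ h ∉ cl η.toFinset a ∧ Sep DX (cl η.toFinset a) b h} x) (fun y => ind {η : BondConfig V | c ∉ cl η.toFinset a ∧ h ∉ cl η.toFinset a ∧ h ∉ cl η.toFinset c} y)
  have e6 := sum_weight_blocks_rc w wX wY (↑DX) hX hX' hY hY' q ({a, h} : Set V) (fun x => ind {η : BondConfig V | b ∉ cl η.toFinset a ∧ h ∉ cl η.toFinset a ∧ h ∈ cl η.toFinset b} x) (fun y => ind {η : BondConfig V | c ∉ cl η.toFinset a ∧ h ∉ cl η.toFinset a ∧ Sep DY (cl η.toFinset a) c h} y)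
  have e7 := sum_weight_blocks_rc w wX wY (↑DX) hX hX' hY hY' q ({a, h} : Set V) (fun x => ind {η : BondConfig V | b ∉ cl η.toFinset a ∧ h ∉ cl η.toFinset a ∧ h ∉ cl η.toFinset b} x) (fun y => ind {η : BondConfig V | c ∉ cl η.toFinset a ∧ h ∉ cl η.toFinset a ∧ Sep DY (cl η.toFinset a) c h} y)
  have e8 := sum_weight_blocks_rc w wX wY (↑DX) hX hX' hY hY' q ({a, h} : Set V) (fun x => ind {η : BondConfig V | b ∉ cl η.toFinset a ∧ h ∉ cl η.toFinset a ∧ Sep DX (cl η.toFinset a) b h} x) (fun y => ind {η : BondConfig V | c ∉ cl η.toFinset a ∧ h ∉ cl η.toFinset a ∧ Sep DY (cl η.toFinset a) c h} y)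
  beta_reduce at e1 e2 e3 e4 e5 e6 e7 e8
  rw [← e1, ← e2, ← e3, ← e4, ← e5, ← e6, ← e7, ← e8]
  simp only [Finset.mul_sum]
  rw [← Finset.sum_add_distrib, ← Finset.sum_add_distrib, ← Finset.sum_add_distrib, ← Finset.sum_add_distrib, ← Finset.sum_add_distrib, ← Finset.sum_add_distrib, ← Finset.sum_sub_distrib]
  refine Finset.sum_congr rfl fun ω _ => by ring

end Sums

end ApexTwoSum

end Summit.CriticalPhenomena.PercolationContinuityZ3.Theorems
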